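import Summits.MatrixMultiplication.MatrixMultiplication.Theses.TropicalBiniPatterns
import Literature.Computability.AlgebraicComplexity.ApproximationOrderBoundProofs

/-!
# MatrixMultiplication / TropicalBiniPatterns — `ApproximationOrderBound`

Route `MatrixMultiplication/TropicalBiniPatterns`, support item `stmt-MatrixMultiplication-8011`
("exhaustion is a decision procedure"): there is ONE function `H(a, b, c, r)` of the format and
`r` such that every complex tensor `t` of format `a × b × c` with algebraic border rank
`R̲(t) ≤ r` already has an approximate decomposition with `r` triads of order `H(a, b, c, r)`,
`R_{H(a,b,c,r)}(t) ≤ r` — so "no pattern of order `≤ H(a,b,c,r)`" proves `R̲(t) > r`.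

This is the qualitative form of T. Lehmkuhl, T. Lickteig, *On the order of approximation in
approximative triadic decompositions of tensors*, Theoret. Comput. Sci. 66 (1989) 1–14, main
Theorem, (ii) ⇒ (iii) (cf. Bürgisser–Clausen–Shokrollahi 1997, §20.7 Notes p. 569). The
Literature PROVES it: `LehmkuhlLickteig1989_approxOrder_bound_holds`
(`Literature/Computability/AlgebraicComplexity/ApproximationOrderBoundProofs.lean` §4, an
ultrapower compactness argument from Alder's theorem
`alder_secantVariety_eq_setOf_algBorderRank_le_holds` over the algebraically closed ultrapower
`ℂ^ℕ/U`), and `exists_uniform_approxOrder_of_fact` (`ApproximationOrderBound.lean`) turns the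
`∀ a b c r, ∃ H` form into one bound FUNCTION by the axiom of choice — which is literally the route
declaration. This file only composes the two; no explicit `H` is produced (the printed explicit
order `δ^r`, `LehmkuhlLickteig1989_explicitOrderBound`, remains an undischarged named fact and is
NOT used here, so the result is unconditional).
-/

-- single-conjunct summit: `Summit.MatrixMultiplication.MatrixMultiplication.…` repeats a component by design
set_option linter.dupNamespace false

namespace Summit.MatrixMultiplication.MatrixMultiplication.Theorems

/-- **Settles `stmt-MatrixMultiplication-8011` (`ApproximationOrderBound`), exact signature.**
There is `H : ℕ → ℕ → ℕ → ℕ → ℕ` with `R̲(t) ≤ r → R_{H(a,b,c,r)}(t) ≤ r` for every complex tensor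
`t` of format `a × b × c` (Lehmkuhl–Lickteig 1989, main Theorem (ii) ⇒ (iii), qualitative form;
proved in tree by ultrapower compactness from Alder's theorem, then choice).
[cite: LehmkuhlLickteig1989, Theorem (§1, p. 2), (ii) ⇒ (iii); cf. BurgisserClausenShokrollahi1997 §20.7 Notes p. 569] -/
theorem approximationOrderBound_proof :
    Summit.MatrixMultiplication.MatrixMultiplication.Theses.TropicalBiniPatterns.ApproximationOrderBound := by
  unfold Summit.MatrixMultiplication.MatrixMultiplication.Theses.TropicalBiniPatterns.ApproximationOrderBound
  exact Literature.Computability.AlgebraicComplexity.exists_uniform_approxOrder_of_fact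
    Literature.Computability.AlgebraicComplexity.LehmkuhlLickteig1989_approxOrder_bound_holds

end Summit.MatrixMultiplication.MatrixMultiplication.Theorems
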